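import Literature.NumberTheory.EllipticCurves.ModularCurveSturmProofs
import Literature.NumberTheory.Automorphic.WohlfahrtTheorem
import HarnessLib

/-!
# Sturm's bound at any cusp width; `M_k(Γ)` is finite-dimensional for every finite-index `Γ`

`Literature/NumberTheory/EllipticCurves/ModularCurveSturmProofs.lean` proves Sturm's bound and the
finite-dimensionality of `M_k(Γ)` for arithmetic groups `Γ ∋ T` (width `1` at `∞`: `Γ₀(N)`,
`Γ₁(N)`), through Mathlib's norm to level one (`ModularForm.norm`) and the level-one Sturm bound
(`ModularForm.sturm_bound_levelOne`). The width-`1` hypothesis enters only in the last step,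
"vanishing coefficients ⇒ exponential decay". Here that step is done at any strict period `h`
(the `q`-expansion in `e^{2πiτ/h}`), which gives the results for ALL arithmetic groups — in
particular for the principal congruence subgroups `Γ(N)` (width `N`) and for the noncongruence
subgroups of finite index that occur in Calegari–Dimitrov–Tang's proof of the unbounded
denominators conjecture (J. Amer. Math. Soc. 38 (2025), arXiv:2109.09040, §4.2, the groups `Γ_N`
with `Γ(2N)`-like cusp widths; their dimension counts `dim M_k(Γ) ≪ k [SL₂(ℤ) : Γ]`):

* `isBigO_exp_of_qExpansion_coeff_eq_zero_of_mem_strictPeriods` — if `aᵢ = 0` for `i < m` in the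
  expansion at the strict period `h`, then `f = O(e^{−2π (m/h) Im τ})`;
* **`modularForm_eq_zero_of_qExpansion_coeff_eq_zero_of_mem_strictPeriods`** (Sturm's bound at
  width `h`): if `aᵢ = 0` for all `i ≤ h⌊kd/12⌋`, `d = [SL₂(ℤ) : Γ ∩ SL₂(ℤ)]`, then `f = 0`;
* **`finiteDimensional_modularForm_and_finrank_le_of_mem_strictPeriods`** —
  `dim M_k(Γ) ≤ h⌊kd/12⌋ + 1`;
* **`finiteDimensional_modularForm_of_finiteIndex`** — `M_k(Γ)` is finite-dimensional for every
  finite-index `Γ ≤ SL₂(ℤ)` and every weight `k ∈ ℤ`, with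
  `finrank_modularForm_le_of_T_pow_mem`: `dim M_k(Γ) ≤ h⌊k[SL₂(ℤ):Γ]/12⌋ + 1` whenever `Tʰ ∈ Γ`.

## References

* J. Sturm, *On the congruence of modular forms*, LNM 1240 (1987), Thm. 1. [Sturm1987]
* F. Diamond, J. Shurman, *A First Course in Modular Forms*, GTM 228, §3.5–3.6 (dimension
  formulas; finite-dimensionality).
* [CalegariDimitrovTang2025] F. Calegari, V. Dimitrov, Y. Tang, J. Amer. Math. Soc. 38 (2025),
  arXiv:2109.09040, §4.2 (finite-index subgroups `Γ_N` and their modular forms).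
-/

noncomputable section

open UpperHalfPlane hiding I
open ModularForm SlashInvariantForm ModularFormClass Filter Asymptotics Complex
open scoped MatrixGroups Topology Real

namespace Literature.NumberTheory.EllipticCurves.ModularForms

section Sturm

variable {𝒢 : Subgroup (GL (Fin 2) ℝ)} [𝒢.IsArithmetic] {F : Type*} [FunLike F ℍ ℂ] {k : ℤ}

omit [𝒢.IsArithmetic] in
/-- **Order of vanishing at `∞` and decay, at the strict period `h`**: if the first `m`
coefficients of the `q`-expansion of `f` in `q = e^{2πiτ/h}` vanish, then
`f(τ) = O(e^{−2π (m/h) Im τ})`. [folklore] -/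
theorem isBigO_exp_of_qExpansion_coeff_eq_zero_of_mem_strictPeriods (f : F) [ModularFormClass F 𝒢 k]
    {h : ℝ} (hh : 0 < h) (hΓ : h ∈ 𝒢.strictPeriods) {m : ℕ}
    (hf : ∀ i < m, (qExpansion h f).coeff i = 0) :
    (⇑f) =O[atImInfty] fun τ ↦ Real.exp (-2 * π * (m / h) * τ.im) := by
  have han : AnalyticAt ℂ (cuspFunction h f) 0 :=
    ModularFormClass.analyticAt_cuspFunction_zero f hh hΓ
  have hord : (m : ℕ∞) ≤ analyticOrderAt (cuspFunction h f) 0 := by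
    rw [natCast_le_analyticOrderAt_iff_iteratedDeriv_eq_zero han]
    intro i hi
    have := hf i hi
    rw [qExpansion_coeff] at this
    simpa [Nat.factorial_ne_zero] using this
  obtain ⟨G, hG, hfG⟩ := (natCast_le_analyticOrderAt han).mp hord
  obtain ⟨C, hC⟩ : ∃ C, ∀ᶠ z in 𝓝 (0 : ℂ), ‖G z‖ ≤ C :=
    ⟨‖G 0‖ + 1, hG.continuousAt.norm.eventually (eventually_le_nhds (lt_add_one _))⟩
  have hev : ∀ᶠ z in 𝓝 (0 : ℂ), ‖cuspFunction h f z‖ ≤ C * ‖z ^ m‖ := by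
    filter_upwards [hfG, hC] with z hz hz'
    rw [hz, sub_zero, norm_smul, mul_comm]
    gcongr
  have hq := (qParam_tendsto_atImInfty hh).eventually hev
  refine IsBigO.of_bound C ?_
  filter_upwards [hq] with τ hτ
  rw [SlashInvariantFormClass.eq_cuspFunction f τ hΓ hh.ne'] at hτ
  refine hτ.trans (le_of_eq ?_)
  rw [norm_pow, Function.Periodic.norm_qParam, UpperHalfPlane.coe_im, ← Real.exp_nat_mul,
    Real.norm_eq_abs, Real.abs_exp]
  congr 1
  field_simp

/-- **Sturm's bound at the cusp width `h`** (the characteristic-zero case of Sturm 1987, Thm. 1,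
for an arbitrary arithmetic group): let `h ≥ 1` be a strict period of `Γ` (`Tʰ ∈ Γ`),
`d = [SL₂(ℤ) : Γ ∩ SL₂(ℤ)]`, and `f = ∑ aₙ qₕⁿ ∈ M_k(Γ)`, `qₕ = e^{2πiτ/h}`, with `aₙ = 0` for all
`n < m` where `m > h⌊kd/12⌋`. Then `f = 0`. (Norm to level one and the level-one Sturm bound,
`coe_eq_zero_of_isBigO_exp'`, with the decay `O(e^{−2π (m/h) Im τ})`.) [cite: Sturm1987, Thm. 1] -/
theorem modularForm_eq_zero_of_qExpansion_coeff_eq_zero_of_mem_strictPeriods (f : ModularForm 𝒢 k)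
    {h : ℕ} (hh : 0 < h) (hΓ : (h : ℝ) ∈ 𝒢.strictPeriods) {m : ℕ}
    (hf : ∀ i < m, (qExpansion (h : ℝ) f).coeff i = 0)
    (hm : h * ((k * Nat.card (𝒮ℒ ⧸ 𝒢.subgroupOf 𝒮ℒ)).toNat / 12) < m) : f = 0 := by
  have hh' : (0 : ℝ) < h := Nat.cast_pos.mpr hh
  refine DFunLike.ext' <| (coe_eq_zero_of_isBigO_exp' f
    (isBigO_exp_of_qExpansion_coeff_eq_zero_of_mem_strictPeriods f hh' hΓ hf) ?_).trans
      ModularForm.coe_zero.symm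
  rw [lt_div_iff₀ hh']
  exact_mod_cast (mul_comm h _ ▸ hm : ((k * Nat.card (𝒮ℒ ⧸ 𝒢.subgroupOf 𝒮ℒ)).toNat / 12) * h < m)

end Sturm

section Finrank

variable {𝒢 : Subgroup (GL (Fin 2) ℝ)} [𝒢.IsArithmetic] [𝒢.HasDetOne] {k : ℤ}

/-- **`M_k(Γ)` is finite-dimensional, with `dim M_k(Γ) ≤ h⌊kd/12⌋ + 1`**, for an arithmetic
group `Γ` of determinant one with strict period `h ≥ 1`, `d = [SL₂(ℤ) : Γ ∩ SL₂(ℤ)]`: the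
coefficients `a_0, …, a_{h⌊kd/12⌋}` of the expansion in `e^{2πiτ/h}` determine the form.
[cite: Sturm1987, Thm. 1] -/
theorem finiteDimensional_modularForm_and_finrank_le_of_mem_strictPeriods {h : ℕ} (hh : 0 < h)
    (hΓ : (h : ℝ) ∈ 𝒢.strictPeriods) :
    FiniteDimensional ℂ (ModularForm 𝒢 k) ∧
      Module.finrank ℂ (ModularForm 𝒢 k) ≤
        h * ((k * Nat.card (𝒮ℒ ⧸ 𝒢.subgroupOf 𝒮ℒ)).toNat / 12) + 1 := by
  have hh' : (0 : ℝ) < h := Nat.cast_pos.mpr hh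
  set B := h * ((k * Nat.card (𝒮ℒ ⧸ 𝒢.subgroupOf 𝒮ℒ)).toNat / 12) with hB
  have han : ∀ f : ModularForm 𝒢 k, AnalyticAt ℂ (cuspFunction (h : ℝ) f) 0 := fun f ↦
    ModularFormClass.analyticAt_cuspFunction_zero f hh' hΓ
  let L : ModularForm 𝒢 k →ₗ[ℂ] (Fin (B + 1) → ℂ) :=
    { toFun := fun f j ↦ (qExpansion (h : ℝ) f).coeff j
      map_add' := fun f g ↦ by
        funext j
        simp only [Pi.add_apply]
        rw [ModularForm.coe_add, qExpansion_add (han f) (han g), map_add]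
      map_smul' := fun c f ↦ by
        funext j
        simp only [Pi.smul_apply, RingHom.id_apply, smul_eq_mul]
        rw [ModularForm.IsGLPos.coe_smul, qExpansion_smul (han f), map_smul, smul_eq_mul] }
  have hL : Function.Injective L := by
    rw [injective_iff_map_eq_zero]
    intro f hf
    exact modularForm_eq_zero_of_qExpansion_coeff_eq_zero_of_mem_strictPeriods f hh hΓ (m := B + 1)
      (fun i hi ↦ congr_fun hf ⟨i, hi⟩) (by omega)
  have hfin : FiniteDimensional ℂ (ModularForm 𝒢 k) := Module.Finite.of_injective L hL
  exact ⟨hfin, (LinearMap.finrank_le_finrank_of_injective hL).trans (Module.finrank_fin_fun ℂ).le⟩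

end Finrank

/-! ### Every finite-index subgroup of `SL₂(ℤ)` -/

section FiniteIndex

open Matrix.SpecialLinearGroup

/-- **Every finite-index `Γ ≤ SL₂(ℤ)` has a strict period `h ≥ 1`** (`Tʰ ∈ Γ` for some
`1 ≤ h ≤ [SL₂(ℤ) : Γ]`). [folklore] -/
theorem exists_T_pow_mem (Γ : Subgroup SL(2, ℤ)) [Γ.FiniteIndex] :
    ∃ h : ℕ, 0 < h ∧ h ≤ Γ.index ∧ ModularGroup.T ^ h ∈ Γ :=
  Γ.exists_pow_mem_of_index_ne_zero Subgroup.FiniteIndex.index_ne_zero ModularGroup.T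

/-- **`dim M_k(Γ) ≤ h⌊k[SL₂(ℤ):Γ]/12⌋ + 1` whenever `Tʰ ∈ Γ`**, for `Γ ≤ SL₂(ℤ)` of finite index
(and `M_k(Γ)` is finite-dimensional). In particular with `h ≤ [SL₂(ℤ) : Γ]` this is the crude
bound `dim M_k(Γ) ≤ [SL₂(ℤ):Γ]·(k[SL₂(ℤ):Γ]/12) + 1`. [cite: Sturm1987, Thm. 1] -/
theorem finrank_modularForm_le_of_T_pow_mem (Γ : Subgroup SL(2, ℤ)) [Γ.FiniteIndex] (k : ℤ)
    {h : ℕ} (hh : 0 < h) (hT : ModularGroup.T ^ h ∈ Γ) :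
    FiniteDimensional ℂ (ModularForm (Γ : Subgroup (GL (Fin 2) ℝ)) k) ∧
      Module.finrank ℂ (ModularForm (Γ : Subgroup (GL (Fin 2) ℝ)) k) ≤
        h * ((k * Γ.index).toNat / 12) + 1 := by
  have := finiteDimensional_modularForm_and_finrank_le_of_mem_strictPeriods (k := k) hh
    (Literature.NumberTheory.Automorphic.Wohlfahrt.natCast_mem_strictPeriods_iff_T_pow_mem.mpr hT)
  rwa [card_quotient_subgroupOf_eq_index] at this

/-- **`M_k(Γ)` is finite-dimensional for every finite-index subgroup `Γ ≤ SL₂(ℤ)` and every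
weight `k ∈ ℤ`** (congruence or not). [cite: Sturm1987, Thm. 1] -/
theorem finiteDimensional_modularForm_of_finiteIndex (Γ : Subgroup SL(2, ℤ)) [Γ.FiniteIndex]
    (k : ℤ) : FiniteDimensional ℂ (ModularForm (Γ : Subgroup (GL (Fin 2) ℝ)) k) := by
  obtain ⟨h, hh, -, hT⟩ := exists_T_pow_mem Γ
  exact (finrank_modularForm_le_of_T_pow_mem Γ k hh hT).1

/-- The crude uniform bound **`dim M_k(Γ) ≤ [SL₂(ℤ):Γ] · ⌊k[SL₂(ℤ):Γ]/12⌋ + 1`** for every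
finite-index `Γ ≤ SL₂(ℤ)`. [cite: Sturm1987, Thm. 1] -/
theorem finrank_modularForm_le_index_mul (Γ : Subgroup SL(2, ℤ)) [Γ.FiniteIndex] (k : ℤ) :
    Module.finrank ℂ (ModularForm (Γ : Subgroup (GL (Fin 2) ℝ)) k) ≤
      Γ.index * ((k * Γ.index).toNat / 12) + 1 := by
  obtain ⟨h, hh, hle, hT⟩ := exists_T_pow_mem Γ
  exact (finrank_modularForm_le_of_T_pow_mem Γ k hh hT).2.trans (by gcongr)

end FiniteIndex

end Literature.NumberTheory.EllipticCurves.ModularForms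

end
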